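import Literature.Probability.RandomPlanarGeometry.SLERestrictionDerivMeasurable
import Literature.Probability.RandomPlanarGeometry.SLEAdaptedProofs
import HarnessLib

/-!
# `h_t'(W_t) = Φ'_{A_t − W_t}(0)` and `dist(W_t, g_t(A))` as adapted processes of SLE_κ

G. F. Lawler, O. Schramm, W. Werner, *Conformal restriction: the chordal case*, J. Amer. Math.
Soc. **16** (2003) 917–955, arXiv:math/0209343 (**[LSW]**), §5: for `A ∈ 𝒬*` and `t < T_A`,
`A_t = g_t(A)`, `h_t = g_{A_t}`, and "`Y_t = h_t'(W_t)^α`, `t < T`, is a local martingale" —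
adaptedness of `Y` to the filtration of `B` being implicit. The measurability of the alive event
`{t < T_A}` and of `ω ↦ Φ'_{A_t − W_t}(0) · 𝟙{t < T_A}` with respect to the path up to time `t` is
PROVED in the tree (`SLERestrictionAlive`, `SLERestrictionDerivMeasurable`: parametrised families of
continuous driving paths from `0`). This file packages the two processes consumed by the
localization of the restriction martingale as TOTAL random variables with documented junk values,
proves the measurability of the distance `dist(0, B_t)` (an infimum over the images of a dense
sequence, `Loewner.slidPt`), and records the SLE_κ instances:

* `Loewner.slidDeriv V A t ω = Φ'_{B_t}(0)` (`starDeriv` of the slid hull `B_t = slidHull (V ω) A t`)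
  while `A` is alive, junk value `1` from `T_A` on — measurable (`Loewner.measurable_slidDeriv`);
* `Loewner.slidDist V A t ω = dist(0, B_t) = dist(W_t, g_t(A))` while alive, junk `0` after —
  measurable (`Loewner.measurable_slidDist`);
* for `V ω = sleDriving κ ω` and the raw Brownian filtration `𝓕ᵂ`: `measurableSet_sleAlive`
  (`{t < T_A} ∈ 𝓕ᵂ_t`), `sleSlidDeriv`, `sleSlidDist`, their `𝓕ᵂ_t`-measurability and
  adaptedness (`adapted_sleSlidDeriv`, `stronglyAdapted_sleSlidDeriv`, `adapted_sleSlidDist`).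

## References

* [LSW] §5 (A_t, h_t, Y_t). [LawlerSchrammWerner2003Restriction]
-/

noncomputable section

open Set Filter Metric Function MeasureTheory
open _root_.Complex _root_.Topology
open UpperHalfPlane (upperHalfPlaneSet)
open scoped NNReal

namespace Literature.Probability.RandomPlanarGeometry

namespace Loewner

variable {W : ℝ≥0 → ℝ} {A : Set ℂ}

/-! ### Aliveness, pointwise -/

/-- Aliveness of `A ⊆ ℍ̄` at time `t` is the pointwise condition `t < T_a`, `a ∈ A`. [folklore] -/
theorem disjoint_closedHull_iff (hA : A ⊆ closure upperHalfPlaneSet) {t : ℝ≥0} :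
    Disjoint (closedHull W t) A ↔ ∀ a ∈ A, (t : WithTop ℝ≥0) < swallowingTime W a := by
  refine ⟨fun h a ha ↦ lt_swallowingTime_of_disjoint_closedHull hA h ha, fun h ↦ ?_⟩
  exact Set.disjoint_left.2 fun z hz hzA ↦ (h z hzA).not_ge hz.2

/-! ### The two total random variables -/

section Parametrised

variable {Ω : Type*} {mΩ : MeasurableSpace Ω} {V : Ω → ℝ≥0 → ℝ} {t : ℝ≥0}

open Classical in
/-- **`h_t'(W_t) = Φ'_{B_t}(0)` as a total random variable**: the restriction derivative of the slid
hull `B_t = g_t(A) − W_t` while `A` is alive, and the junk value `1` from `T_A` on.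
[cite: LawlerSchrammWerner2003Restriction, §5 (h_t'(W_t))] -/
def slidDeriv (V : Ω → ℝ≥0 → ℝ) (A : Set ℂ) (t : ℝ≥0) (ω : Ω) : ℝ :=
  if Disjoint (closedHull (V ω) t) A then starDeriv (slidHull (V ω) A t) else 1

open Classical in
/-- **`dist(W_t, g_t(A)) = dist(0, B_t)` as a total random variable** (junk value `0` from `T_A` on).
[cite: LawlerSchrammWerner2003Restriction, §5 (A_t = g_t(A))] -/
def slidDist (V : Ω → ℝ≥0 → ℝ) (A : Set ℂ) (t : ℝ≥0) (ω : Ω) : ℝ :=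
  if Disjoint (closedHull (V ω) t) A then infDist 0 (slidHull (V ω) A t) else 0

omit mΩ in
/-- Unfolding of `slidDeriv` on the alive event. [folklore] -/
theorem slidDeriv_of_disjoint {ω : Ω} (h : Disjoint (closedHull (V ω) t) A) :
    slidDeriv V A t ω = starDeriv (slidHull (V ω) A t) := by
  classical
  exact if_pos h

omit mΩ in
/-- Unfolding of `slidDist` on the alive event. [folklore] -/
theorem slidDist_of_disjoint {ω : Ω} (h : Disjoint (closedHull (V ω) t) A) :
    slidDist V A t ω = infDist 0 (slidHull (V ω) A t) := by
  classical
  exact if_pos h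

omit mΩ in
/-- Values of `slidDeriv`: in `(0, 1]`. [cite: LawlerSchrammWerner2003Restriction, §2 (2.4)] -/
theorem slidDeriv_mem_Ioc (hc : ∀ ω, Continuous (V ω)) (hA : IsStarHull A) (ω : Ω) :
    slidDeriv V A t ω ∈ Ioc (0 : ℝ) 1 := by
  classical
  rw [slidDeriv]
  split_ifs with h
  · obtain ⟨h0, h1, -⟩ := starDeriv_spec (isStarHull_slidHull_of_disjoint (hc ω) hA h)
    exact ⟨h0, h1⟩
  · exact ⟨one_pos, le_rfl⟩

omit mΩ in
/-- Values of `slidDist`: non-negative. [folklore] -/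
theorem slidDist_nonneg (ω : Ω) : 0 ≤ slidDist V A t ω := by
  classical
  rw [slidDist]
  split_ifs
  · exact infDist_nonneg
  · exact le_rfl

/-- **`h_t'(W_t)` is measurable with respect to the path up to time `t`**
(`measurable_indicator_starDeriv_slidHull` of `SLERestrictionDerivMeasurable`, plus the junk value
on the complement of the measurable alive event). [cite: LawlerSchrammWerner2003Restriction, §5 (h_t'(W_t))] -/
theorem measurable_slidDeriv (hc : ∀ ω, Continuous (V ω)) (hV0 : ∀ ω, V ω 0 = 0)
    (hmeas : ∀ s, s ≤ t → Measurable fun ω ↦ V ω s) (hA : IsStarHull A) (hne : A.Nonempty) :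
    Measurable (slidDeriv V A t) := by
  classical
  have hEv := measurableSet_disjoint_closedHull hc hV0 hmeas hA hne
  have hind := measurable_indicator_starDeriv_slidHull hc hV0 hmeas hA hne
  have heq : slidDeriv V A t = fun ω ↦
      Set.indicator {ω | Disjoint (closedHull (V ω) t) A} (fun ω ↦ starDeriv (slidHull (V ω) A t)) ω +
        Set.indicator {ω | Disjoint (closedHull (V ω) t) A}ᶜ (fun _ ↦ (1 : ℝ)) ω := by
    ext ω
    by_cases h : Disjoint (closedHull (V ω) t) A
    · rw [slidDeriv, if_pos h, indicator_of_mem (show ω ∈ {ω | Disjoint (closedHull (V ω) t) A} from h),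
        indicator_of_notMem (show ω ∉ {ω | Disjoint (closedHull (V ω) t) A}ᶜ from fun h' ↦ h' h), add_zero]
    · rw [slidDeriv, if_neg h, indicator_of_notMem (show ω ∉ {ω | Disjoint (closedHull (V ω) t) A} from h),
        indicator_of_mem (show ω ∈ {ω | Disjoint (closedHull (V ω) t) A}ᶜ from h), zero_add]
  rw [heq]
  exact hind.add (measurable_const.indicator hEv.compl)

/-- On the alive event the slid hull is the closure of the slid points of a dense sequence
(`slidHull_subset_closure_range_slidPt` and closedness of the slid hull). [folklore] -/
theorem slidHull_eq_closure_range_slidPt {ω : Ω} (hW : Continuous (V ω)) (hA : IsStarHull A)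
    {a : ℕ → ℂ} (ha : ∀ k, a k ∈ A) (hdense : A ⊆ closure (range a))
    (halive : Disjoint (closedHull (V ω) t) A) :
    slidHull (V ω) A t = closure (range fun k ↦ slidPt V a t k ω) := by
  refine le_antisymm (slidHull_subset_closure_range_slidPt hW hA hdense halive) ?_
  refine closure_minimal ?_ (isStarHull_slidHull_of_disjoint hW hA halive).isBoundedHull.isClosed
  rintro _ ⟨k, rfl⟩
  exact slidPt_mem ha k ω

/-- **`dist(W_t, g_t(A))` is measurable with respect to the path up to time `t`** (an infimum of
the norms of the slid points of a dense sequence in `A ∩ ℍ`, each measurable by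
`LoewnerAdaptedPlane`). [cite: LawlerSchrammWerner2003Restriction, §5 (A_t = g_t(A))] -/
theorem measurable_slidDist (hc : ∀ ω, Continuous (V ω)) (hV0 : ∀ ω, V ω 0 = 0)
    (hmeas : ∀ s, s ≤ t → Measurable fun ω ↦ V ω s) (hA : IsStarHull A) (hne : A.Nonempty) :
    Measurable (slidDist V A t) := by
  classical
  have hEv := measurableSet_disjoint_closedHull hc hV0 hmeas hA hne
  obtain ⟨a, ha, hdense⟩ := exists_denseSeq hA hne
  have hwm : ∀ k, Measurable (slidPt V a t k) := fun k ↦ measurable_slidPt hc hmeas (fun k ↦ (ha k).2) k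
  have hF : Measurable fun ω ↦ ⨅ k, ‖slidPt V a t k ω‖ := Measurable.iInf fun k ↦ (hwm k).norm
  have heq : slidDist V A t = fun ω ↦
      if Disjoint (closedHull (V ω) t) A then ⨅ k, ‖slidPt V a t k ω‖ else 0 := by
    ext ω
    rw [slidDist]
    by_cases h : Disjoint (closedHull (V ω) t) A
    · rw [if_pos h, if_pos h, slidHull_eq_closure_range_slidPt (hc ω) hA (fun k ↦ (ha k).1) hdense h,
        infDist_closure]
      -- `infDist 0 (range f) = ⨅ k, ‖f k‖`
      have hbdd : BddBelow (range fun k ↦ ‖slidPt V a t k ω‖) := ⟨0, by rintro _ ⟨k, rfl⟩; exact norm_nonneg _⟩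
      refine le_antisymm (le_ciInf fun k ↦ ?_) ?_
      · have := infDist_le_dist_of_mem (x := (0 : ℂ)) (mem_range_self (f := fun k ↦ slidPt V a t k ω) k)
        rwa [dist_zero_left] at this
      · refine (le_infDist (range_nonempty _)).2 ?_
        rintro _ ⟨k, rfl⟩
        rw [dist_zero_left]
        exact ciInf_le hbdd k
    · rw [if_neg h, if_neg h]
  rw [heq]
  exact Measurable.ite hEv hF measurable_const

end Parametrised

end Loewner

/-! ### The SLE_κ instances: adaptedness to the Brownian filtration -/

section SLE

variable (κ : ℝ≥0) {A : Set ℂ}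

/-- **`{t < T_A} ∈ 𝓕ᵂ_t`** for the SLE_κ driving function and a nonempty `*`-hull `A`
(`Loewner.measurableSet_disjoint_closedHull` of `SLERestrictionAlive`).
[cite: LawlerSchrammWerner2003Restriction, §5 (T = T_A)] -/
theorem measurableSet_sleAlive (hA : IsStarHull A) (hne : A.Nonempty) (t : ℝ≥0) :
    MeasurableSet[brownianFiltration t] {ω | Disjoint (Loewner.closedHull (sleDriving κ ω) t) A} :=
  Loewner.measurableSet_disjoint_closedHull (mΩ := brownianFiltration t) (W := fun ω ↦ sleDriving κ ω)
    (fun ω ↦ continuous_sleDriving κ ω) (fun ω ↦ sleDriving_zero κ ω)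
    (fun _ hs ↦ measurable_sleDriving_of_le κ hs) hA hne

/-- **`h_t'(W_t) = Φ'_{A_t − W_t}(0)` of SLE_κ** (junk value `1` from `T_A` on), as a process on the
canonical space. [cite: LawlerSchrammWerner2003Restriction, §5 (Y_t = h_t'(W_t)^α)] -/
def sleSlidDeriv (A : Set ℂ) (t : ℝ≥0) (ω : ℝ≥0 → ℝ) : ℝ :=
  Loewner.slidDeriv (fun ω ↦ sleDriving κ ω) A t ω

/-- **`dist(W_t, g_t(A))` of SLE_κ** (junk value `0` from `T_A` on). [cite: LawlerSchrammWerner2003Restriction, §5 (A_t)] -/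
def sleSlidDist (A : Set ℂ) (t : ℝ≥0) (ω : ℝ≥0 → ℝ) : ℝ :=
  Loewner.slidDist (fun ω ↦ sleDriving κ ω) A t ω

/-- Unfolding of `sleSlidDeriv` before `T_A`. [folklore] -/
theorem sleSlidDeriv_of_disjoint {t : ℝ≥0} {ω : ℝ≥0 → ℝ}
    (h : Disjoint (Loewner.closedHull (sleDriving κ ω) t) A) :
    sleSlidDeriv κ A t ω = starDeriv (Loewner.slidHull (sleDriving κ ω) A t) :=
  Loewner.slidDeriv_of_disjoint (V := fun ω ↦ sleDriving κ ω) h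

/-- Unfolding of `sleSlidDist` before `T_A`. [folklore] -/
theorem sleSlidDist_of_disjoint {t : ℝ≥0} {ω : ℝ≥0 → ℝ}
    (h : Disjoint (Loewner.closedHull (sleDriving κ ω) t) A) :
    sleSlidDist κ A t ω = infDist 0 (Loewner.slidHull (sleDriving κ ω) A t) :=
  Loewner.slidDist_of_disjoint (V := fun ω ↦ sleDriving κ ω) h

/-- `sleSlidDeriv ∈ (0, 1]`. [cite: LawlerSchrammWerner2003Restriction, §2 (2.4)] -/
theorem sleSlidDeriv_mem_Ioc (hA : IsStarHull A) (t : ℝ≥0) (ω : ℝ≥0 → ℝ) :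
    sleSlidDeriv κ A t ω ∈ Ioc (0 : ℝ) 1 :=
  Loewner.slidDeriv_mem_Ioc (fun ω ↦ continuous_sleDriving κ ω) hA ω

/-- `0 ≤ sleSlidDist`. [folklore] -/
theorem sleSlidDist_nonneg (A : Set ℂ) (t : ℝ≥0) (ω : ℝ≥0 → ℝ) : 0 ≤ sleSlidDist κ A t ω :=
  Loewner.slidDist_nonneg ω

/-- **`h_t'(W_t)` is `𝓕ᵂ_t`-measurable.** [cite: LawlerSchrammWerner2003Restriction, §5 (Y_t = h_t'(W_t)^α)] -/
theorem measurable_sleSlidDeriv (hA : IsStarHull A) (hne : A.Nonempty) (t : ℝ≥0) :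
    Measurable[brownianFiltration t] (sleSlidDeriv κ A t) :=
  Loewner.measurable_slidDeriv (mΩ := brownianFiltration t) (V := fun ω ↦ sleDriving κ ω)
    (fun ω ↦ continuous_sleDriving κ ω) (fun ω ↦ sleDriving_zero κ ω)
    (fun _ hs ↦ measurable_sleDriving_of_le κ hs) hA hne

/-- **`dist(W_t, g_t(A))` is `𝓕ᵂ_t`-measurable.** [cite: LawlerSchrammWerner2003Restriction, §5 (A_t)] -/
theorem measurable_sleSlidDist (hA : IsStarHull A) (hne : A.Nonempty) (t : ℝ≥0) :
    Measurable[brownianFiltration t] (sleSlidDist κ A t) :=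
  Loewner.measurable_slidDist (mΩ := brownianFiltration t) (V := fun ω ↦ sleDriving κ ω)
    (fun ω ↦ continuous_sleDriving κ ω) (fun ω ↦ sleDriving_zero κ ω)
    (fun _ hs ↦ measurable_sleDriving_of_le κ hs) hA hne

/-- **The process `t ↦ h_t'(W_t)` is adapted to `𝓕ᵂ`** ([LSW] §5, implicit).
[cite: LawlerSchrammWerner2003Restriction, §5 (Y_t = h_t'(W_t)^α)] -/
theorem adapted_sleSlidDeriv (hA : IsStarHull A) (hne : A.Nonempty) :
    Adapted brownianFiltration (sleSlidDeriv κ A) := fun t ↦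
  measurable_sleSlidDeriv κ hA hne t

/-- The process `t ↦ h_t'(W_t)` is strongly adapted to `𝓕ᵂ`. [folklore] -/
theorem stronglyAdapted_sleSlidDeriv (hA : IsStarHull A) (hne : A.Nonempty) :
    StronglyAdapted brownianFiltration (sleSlidDeriv κ A) := fun t ↦
  (measurable_sleSlidDeriv κ hA hne t).stronglyMeasurable

/-- The process `t ↦ dist(W_t, g_t(A))` is adapted to `𝓕ᵂ`. [folklore] -/
theorem adapted_sleSlidDist (hA : IsStarHull A) (hne : A.Nonempty) :
    Adapted brownianFiltration (sleSlidDist κ A) := fun t ↦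
  measurable_sleSlidDist κ hA hne t

end SLE

end Literature.Probability.RandomPlanarGeometry

end
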